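import Summits.CriticalPhenomena.PercolationContinuityZ3.Theorems.PercNearOneGluingNoHeavyLowerTailCubicFourPointL1Cells
import Mathlib.Tactic.Ring
import Mathlib.Tactic.Linarith
import Mathlib.Tactic.Positivity
import HarnessLib

/-!
# `NoHeavyLowerTail` (stmt-CriticalPhenomena-4575) — (L1) on the coordinate face `supp(V3)`: an exact degree-4 certificate from SHK3⁺, the hybrid row `E1` and two increasing-event `E₃` rows

Support file (prover prim-facecert, Engine-A client; `--supports stmt-CriticalPhenomena-4575`).  Pure algebra, no sorries, no named facts, no new definitions
(vocabulary: `HybMasses.ofCells/.L1/.E1`, `E3h`, `CubicThreePointStep.F`).  Companion of `…CubicFourPointL1FaceCert` (the face `supp(V1)`).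

Lean replay of the machine-found certificate `certs/FC_suppV3_L1_D4_KM1_S10.json` of the facecert package
(run/shared/lean/prim/prim-l12/prim-facecert/facecert-bench-v1; face-reduced Handelman LP, total degree 4, linear multiplier; exact reconstruction, verifier B residual 0).

SETTING.  `supp(V3)` = the coordinate face on which the five cells `a|b|cy, ac|b|y, ac|by, acy|b, ab|cy` vanish ("`c` is never joined to `a` or `y` except
through `b`"); it contains the tight variety `V3 = CUT:b:ay|c` (`HybMasses.L1_cells_cut_b_ay_c`: `L1 ≡ 0` there, with `E1 ≡ 0`, `E2 ≡ β₃·m(D_bc)`).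
Live cells `x₁=a|b|c|y, x₃=a|by|c, x₄=a|bc|y, x₅=ay|b|c, x₇=ab|c|y, x₈=a|bcy, x₉=ay|bc, x₁₃=aby|c, x₁₄=abc|y, x₁₅=abcy`;
`x⁰ = (x₁+x₃+x₅, x₇+x₁₃, 0, x₄+x₈+x₉, x₁₄+x₁₅)`, `x¹ = (x₁+x₅, x₃+x₇+x₁₃, 0, x₄+x₉, x₈+x₁₄+x₁₅)` (as `(q,u₁,u₂,u₃,t)`; `u₂ = 0` on this face).
The two extra rows are Richards–Sahi cubics of three INCREASING connection events (Sahi `C₃` / Kahn Conjecture-5 instances, census-validated, here hypotheses):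
`E49 = E₃(c ~ {a,b,y}, b ~ {a,c,y}, {a,y} ~ {b,c})`, `E66 = E₃(c ~ {a,b,y}, b ~ {a,c}, a ~ {b,c})` (E3GRP rows #49, #66 of harness-2's dictionary), written with `E3h 1 …`
on the cell sums of the events and their intersections.

RESULT (`L1_cells_suppV3_certificate`, `ring` at total mass one), with `M = 2x₁₅+2x₁₄+2x₁₃+2x₉+2x₈+2x₇+4x₅+2x₄+4x₃+4x₁`:
    `M·L1 = M·F(x⁰) + M′·F(x¹) + 2x₃·E1 + s·E49 + 2x₈·E66`,  `M′ = x₁₅+x₁₄+x₁₃+x₉+x₈+x₇+2x₅+x₄+x₃+2x₁`, `s = 2x₁₅+2x₁₄+x₁₃+x₉+x₇+x₅+x₄+x₃+x₁`;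
hence (`L1_cells_suppV3_nonneg`) (L1) on this face from `F(x⁰), F(x¹) ≥ 0` (SHK3⁺, tree theorems for realizable laws), `E1 ≥ 0`, `E49 ≥ 0`, `E66 ≥ 0` and nonnegative cells.
By the first-order analysis of the package (FACECERT-SPEC §4) a hybrid/`C₃` row is NECESSARY on this face (the cone test fails for {cells, F(x⁰), F(x¹), Harris, AG}).
NOT here: `supp(V4)` (apply `b ↔ c`), the full simplex.
-/

namespace Summit.CriticalPhenomena.PercolationContinuityZ3.Theorems

namespace HybMasses

open CubicThreePointStep

variable {R : Type*} [CommRing R]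

/-- **Exact certificate for (L1) on the coordinate face `supp(V3)`** (cells `a|b|cy = ac|b|y = ac|by = acy|b = ab|cy = 0`, total mass one):
`M·L1 = M·F(x⁰) + M′·F(x¹) + 2x₃·E1 + s·E49 + 2x₈·E66` (machine-found, degree 4, linear multipliers; re-proved by `ring`). -/
theorem L1_cells_suppV3_certificate (x₁ x₃ x₄ x₅ x₇ x₈ x₉ x₁₃ x₁₄ x₁₅ : R)
    (hσ : x₁ + x₃ + x₄ + x₅ + x₇ + x₈ + x₉ + x₁₃ + x₁₄ + x₁₅ = 1) :
    (2 * x₁₅ + 2 * x₁₄ + 2 * x₁₃ + 2 * x₉ + 2 * x₈ + 2 * x₇ + 4 * x₅ + 2 * x₄ + 4 * x₃ + 4 * x₁) * (ofCells x₁ 0 x₃ x₄ x₅ 0 x₇ x₈ x₉ 0 0 0 x₁₃).L1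
      = (2 * x₁₅ + 2 * x₁₄ + 2 * x₁₃ + 2 * x₉ + 2 * x₈ + 2 * x₇ + 4 * x₅ + 2 * x₄ + 4 * x₃ + 4 * x₁) * F (x₁ + x₃ + x₅) (x₇ + x₁₃) 0 (x₄ + x₈ + x₉) (x₁₄ + x₁₅)
        + (x₁₅ + x₁₄ + x₁₃ + x₉ + x₈ + x₇ + 2 * x₅ + x₄ + x₃ + 2 * x₁) * F (x₁ + x₅) (x₃ + x₇ + x₁₃) 0 (x₄ + x₉) (x₈ + x₁₄ + x₁₅)
        + 2 * x₃ * (ofCells x₁ 0 x₃ x₄ x₅ 0 x₇ x₈ x₉ 0 0 0 x₁₃).E1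
        + (2 * x₁₅ + 2 * x₁₄ + x₁₃ + x₉ + x₇ + x₅ + x₄ + x₃ + x₁)
            * E3h 1 (x₄ + x₈ + x₉ + x₁₄ + x₁₅) (x₃ + x₄ + x₇ + x₈ + x₉ + x₁₃ + x₁₄ + x₁₅) (x₃ + x₇ + x₈ + x₁₃ + x₁₄ + x₁₅)
                (x₄ + x₈ + x₉ + x₁₄ + x₁₅) (x₈ + x₁₄ + x₁₅) (x₃ + x₇ + x₈ + x₁₃ + x₁₄ + x₁₅) (x₈ + x₁₄ + x₁₅)
        + 2 * x₈ * E3h 1 (x₄ + x₈ + x₉ + x₁₄ + x₁₅) (x₄ + x₇ + x₈ + x₉ + x₁₃ + x₁₄ + x₁₅) (x₇ + x₁₃ + x₁₄ + x₁₅)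
                (x₄ + x₈ + x₉ + x₁₄ + x₁₅) (x₁₄ + x₁₅) (x₇ + x₁₃ + x₁₄ + x₁₅) (x₁₄ + x₁₅) := by
  have h : x₁₅ = 1 - x₁ - x₃ - x₄ - x₅ - x₇ - x₈ - x₉ - x₁₃ - x₁₄ := by rw [← hσ]; ring
  subst h
  simp only [ofCells, L1, E1, E3h, F]
  ring

/-- **(L1) on `supp(V3)`** from SHK3⁺ at `x⁰, x¹`, the hybrid row `E1 = E₃(D_bc, D_ac, G_ab) ≥ 0` and the two increasing-event rows `E49, E66 ≥ 0`
(three Sahi-`C₃` instances), given nonnegative live cells of total mass one. -/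
theorem L1_cells_suppV3_nonneg {x₁ x₃ x₄ x₅ x₇ x₈ x₉ x₁₃ x₁₄ x₁₅ : ℝ}
    (hσ : x₁ + x₃ + x₄ + x₅ + x₇ + x₈ + x₉ + x₁₃ + x₁₄ + x₁₅ = 1)
    (h₁ : 0 ≤ x₁) (h₃ : 0 ≤ x₃) (h₄ : 0 ≤ x₄) (h₅ : 0 ≤ x₅) (h₇ : 0 ≤ x₇) (h₈ : 0 ≤ x₈) (h₉ : 0 ≤ x₉) (h₁₃ : 0 ≤ x₁₃) (h₁₄ : 0 ≤ x₁₄) (h₁₅ : 0 ≤ x₁₅)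
    (hF0 : 0 ≤ F (x₁ + x₃ + x₅) (x₇ + x₁₃) 0 (x₄ + x₈ + x₉) (x₁₄ + x₁₅))
    (hF1 : 0 ≤ F (x₁ + x₅) (x₃ + x₇ + x₁₃) 0 (x₄ + x₉) (x₈ + x₁₄ + x₁₅))
    (hE1 : 0 ≤ (ofCells x₁ 0 x₃ x₄ x₅ 0 x₇ x₈ x₉ 0 0 0 x₁₃).E1)
    (hE49 : 0 ≤ E3h 1 (x₄ + x₈ + x₉ + x₁₄ + x₁₅) (x₃ + x₄ + x₇ + x₈ + x₉ + x₁₃ + x₁₄ + x₁₅) (x₃ + x₇ + x₈ + x₁₃ + x₁₄ + x₁₅)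
                (x₄ + x₈ + x₉ + x₁₄ + x₁₅) (x₈ + x₁₄ + x₁₅) (x₃ + x₇ + x₈ + x₁₃ + x₁₄ + x₁₅) (x₈ + x₁₄ + x₁₅))
    (hE66 : 0 ≤ E3h 1 (x₄ + x₈ + x₉ + x₁₄ + x₁₅) (x₄ + x₇ + x₈ + x₉ + x₁₃ + x₁₄ + x₁₅) (x₇ + x₁₃ + x₁₄ + x₁₅)
                (x₄ + x₈ + x₉ + x₁₄ + x₁₅) (x₁₄ + x₁₅) (x₇ + x₁₃ + x₁₄ + x₁₅) (x₁₄ + x₁₅)) :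
    0 ≤ (ofCells x₁ 0 x₃ x₄ x₅ 0 x₇ x₈ x₉ 0 0 0 x₁₃).L1 := by
  have hid := L1_cells_suppV3_certificate x₁ x₃ x₄ x₅ x₇ x₈ x₉ x₁₃ x₁₄ x₁₅ hσ
  have hM : 0 < 2 * x₁₅ + 2 * x₁₄ + 2 * x₁₃ + 2 * x₉ + 2 * x₈ + 2 * x₇ + 4 * x₅ + 2 * x₄ + 4 * x₃ + 4 * x₁ := by linarith
  have hM' : 0 ≤ x₁₅ + x₁₄ + x₁₃ + x₉ + x₈ + x₇ + 2 * x₅ + x₄ + x₃ + 2 * x₁ := by linarith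
  have hs : 0 ≤ 2 * x₁₅ + 2 * x₁₄ + x₁₃ + x₉ + x₇ + x₅ + x₄ + x₃ + x₁ := by linarith
  have hrhs : 0 ≤ (2 * x₁₅ + 2 * x₁₄ + 2 * x₁₃ + 2 * x₉ + 2 * x₈ + 2 * x₇ + 4 * x₅ + 2 * x₄ + 4 * x₃ + 4 * x₁) * (ofCells x₁ 0 x₃ x₄ x₅ 0 x₇ x₈ x₉ 0 0 0 x₁₃).L1 := by
    rw [hid]
    have t1 := mul_nonneg hM.le hF0
    have t2 := mul_nonneg hM' hF1
    have t3 : 0 ≤ 2 * x₃ * (ofCells x₁ 0 x₃ x₄ x₅ 0 x₇ x₈ x₉ 0 0 0 x₁₃).E1 := mul_nonneg (by linarith) hE1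
    have t4 := mul_nonneg hs hE49
    have t5 : 0 ≤ 2 * x₈ * E3h 1 (x₄ + x₈ + x₉ + x₁₄ + x₁₅) (x₄ + x₇ + x₈ + x₉ + x₁₃ + x₁₄ + x₁₅) (x₇ + x₁₃ + x₁₄ + x₁₅)
                (x₄ + x₈ + x₉ + x₁₄ + x₁₅) (x₁₄ + x₁₅) (x₇ + x₁₃ + x₁₄ + x₁₅) (x₁₄ + x₁₅) := mul_nonneg (by linarith) hE66
    linarith
  exact (mul_nonneg_iff_of_pos_left hM).mp hrhs

end HybMasses

end Summit.CriticalPhenomena.PercolationContinuityZ3.Theorems
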